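import Literature.Computability.Complexity.SuccinctSkeletonReductions
import HarnessLib

/-!
# Compiling constant-arity Boolean constraints into `3`-clauses

Literature / complexity toolkit (serves the quasi-linear succinct Cook–Levin reduction behind
Williams' Fact 3.1, leaf `Williams2014_fact_3_1_skeleton`). The tableau of a computation is a
conjunction of LOCAL constraints, each a Boolean relation among at most six variables. This
file compiles one such constraint into a fixed block of `256` clauses of width `≤ 3` over the
constraint's variables and a private block of `256` auxiliary variables, uniformly in the
constraint (so that "clause `j` of constraint `c`" is computable by arithmetic on `j`): the
`64` rows `ρ` of the truth table each own `4` clause slots; a row on which the relation holds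
contributes tautologies, a falsifying row contributes its blocking clause
`⋁ᵢ (xᵢ ≠ ρᵢ)` of width `6`, split into the chain
`(l₀ ∨ l₁ ∨ z₁) (¬z₁ ∨ l₂ ∨ z₂) (¬z₂ ∨ l₃ ∨ z₃) (¬z₃ ∨ l₄ ∨ l₅)` with three fresh variables
(the textbook width reduction, Arora–Barak 2009, proof of Lemma 2.14 / Cook 1971).

* `Con` — a constraint: six variable indices and a predicate on six bits; `Con.Sat`;
* `row ρ`, `rowOf α` — truth-table rows as numbers `< 64` (bit `i` = `ρ / 2ⁱ % 2`);
* `Con.clause c aux j` — clause `j < 256` of the compiled block (`tautClause` beyond), all of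
  width `≤ 3` (`length_clause_le`) on the variables of `c` and `aux + m`, `m < 256`
  (`vars_clause`);
* **`sat_of_clauses`** (soundness): an assignment satisfying the block satisfies the constraint;
* **`clauses_of_sat`** (completeness): an assignment satisfying the constraint and giving the
  auxiliary block the values `zval` satisfies every clause of the block.

## References

* S. Arora, B. Barak, *Computational Complexity: A Modern Approach*, CUP 2009, Lemma 2.14
  (CNF-SAT to 3SAT by splitting clauses with new variables) [AroraBarak2009].
* S. A. Cook, *The complexity of theorem-proving procedures*, STOC 1971, Thm. 2 [Cook1971].
-/

namespace Literature.Computability.Complexity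

namespace ThreeCNF

/-! ### Rows of a truth table as numbers -/

/-- Bit `i` of `n`. [folklore] -/
def bit (i n : ℕ) : Bool := decide (n / 2 ^ i % 2 = 1)

/-- The number with the first `A` bits given by `α`. [folklore] -/
def ofBits (α : ℕ → Bool) : ℕ → ℕ
  | 0 => 0
  | A + 1 => (if α 0 then 1 else 0) + 2 * ofBits (fun i => α (i + 1)) A

/-- `ofBits α A < 2 ^ A`. [folklore] -/
theorem ofBits_lt (α : ℕ → Bool) : ∀ A, ofBits α A < 2 ^ A
  | 0 => Nat.one_pos
  | A + 1 => by
    have := ofBits_lt (fun i => α (i + 1)) A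
    show (if α 0 then 1 else 0) + 2 * ofBits (fun i => α (i + 1)) A < 2 ^ (A + 1)
    rw [Nat.pow_succ]
    split_ifs <;> omega

/-- The bits of `ofBits α A` are `α`. [folklore] -/
theorem bit_ofBits (α : ℕ → Bool) : ∀ (A i : ℕ), i < A → bit i (ofBits α A) = α i
  | 0, i, hi => absurd hi (Nat.not_lt_zero i)
  | A + 1, 0, _ => by
    show decide (((if α 0 then 1 else 0) + 2 * ofBits (fun i => α (i + 1)) A) / 2 ^ 0 % 2 = 1) = α 0
    rw [Nat.pow_zero, Nat.div_one, Nat.add_mul_mod_self_left]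
    cases α 0 <;> decide
  | A + 1, i + 1, hi => by
    have ih := bit_ofBits (fun i => α (i + 1)) A i (Nat.lt_of_succ_lt_succ hi)
    have hq : ofBits α (A + 1) / 2 ^ (i + 1) = ofBits (fun i => α (i + 1)) A / 2 ^ i := by
      show ((if α 0 then 1 else 0) + 2 * ofBits (fun i => α (i + 1)) A) / 2 ^ (i + 1) = _
      rw [Nat.pow_succ', ← Nat.div_div_eq_div_mul, Nat.add_mul_div_left _ _ two_pos]
      have h0 : (if α 0 then 1 else 0) / 2 = 0 := by split_ifs <;> rfl
      rw [h0, Nat.zero_add]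
    simp only [bit] at ih ⊢
    rw [hq]
    exact ih

/-- Row `ρ` of a truth table on six bits. [folklore] -/
def row (ρ : ℕ) : Fin 6 → Bool := fun i => bit i ρ

/-- The row number of an assignment of six bits. [folklore] -/
def rowOf (α : Fin 6 → Bool) : ℕ := ofBits (fun i => if h : i < 6 then α ⟨i, h⟩ else false) 6

/-- `rowOf α < 64`. [folklore] -/
theorem rowOf_lt (α : Fin 6 → Bool) : rowOf α < 64 := ofBits_lt _ 6

/-- The row of `rowOf α` is `α`. [folklore] -/
@[simp] theorem row_rowOf (α : Fin 6 → Bool) : row (rowOf α) = α := by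
  funext i
  simp only [row, rowOf]
  rw [bit_ofBits _ 6 i i.2, dif_pos i.2]

/-! ### Constraints and their compiled clauses -/

/-- A **local constraint**: six variable indices and a Boolean relation among their values
(constraints of smaller arity repeat a variable). [cite: Cook1971, Thm. 2] -/
structure Con where
  /-- The variables, by index. -/
  vars : Fin 6 → ℕ
  /-- The relation to hold among their values. -/
  pred : (Fin 6 → Bool) → Bool

/-- The assignment `σ` satisfies the constraint `c`. [folklore] -/
def Con.Sat (σ : ℕ → Bool) (c : Con) : Prop := c.pred (fun i => σ (c.vars i)) = true

/-- Literal `i` of the blocking clause of row `ρ`: "variable `i` differs from bit `i` of `ρ`".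
[cite: AroraBarak2009, Lemma 2.14] -/
def Con.lit (c : Con) (ρ : ℕ) (i : Fin 6) : Literal ℕ := (c.vars i, !(row ρ i))

/-- The four chain clauses of the blocking clause of row `ρ`, with auxiliary variables
`aux + 4ρ`, `aux + 4ρ + 1`, `aux + 4ρ + 2`. [cite: AroraBarak2009, Lemma 2.14] -/
def Con.chain (c : Con) (aux ρ t : ℕ) : Clause ℕ :=
  if t = 0 then [c.lit ρ 0, c.lit ρ 1, (aux + 4 * ρ, true)]
  else if t = 1 then [(aux + 4 * ρ, false), c.lit ρ 2, (aux + 4 * ρ + 1, true)]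
  else if t = 2 then [(aux + 4 * ρ + 1, false), c.lit ρ 3, (aux + 4 * ρ + 2, true)]
  else if t = 3 then [(aux + 4 * ρ + 2, false), c.lit ρ 4, c.lit ρ 5]
  else tautClause

/-- **Clause `j` of the compiled block** of the constraint `c` with auxiliary block starting at
`aux`: for `j = 4ρ + t < 256`, a tautology if the relation holds on row `ρ`, else chain clause
`t` of row `ρ`; `tautClause` for `j ≥ 256`. [cite: AroraBarak2009, Lemma 2.14] -/
def Con.clause (c : Con) (aux j : ℕ) : Clause ℕ :=
  if j < 256 then (if c.pred (row (j / 4)) then tautClause else c.chain aux (j / 4) (j % 4))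
  else tautClause

/-- Compiled clauses have width at most `3`. [folklore] -/
theorem Con.length_clause_le (c : Con) (aux j : ℕ) : (c.clause aux j).length ≤ 3 := by
  unfold Con.clause
  split_ifs
  · simp
  · have : j % 4 < 4 := Nat.mod_lt j (by decide)
    interval_cases hjm : (j % 4) <;> simp [Con.chain]
  · simp

/-- Every variable of a compiled clause is a variable of the constraint, an auxiliary variable
`aux + m` with `m < 256`, or the variable `0` of `tautClause`. [folklore] -/
theorem Con.vars_clause (c : Con) (aux j : ℕ) :
    ∀ l ∈ c.clause aux j, (∃ i, l.1 = c.vars i) ∨ (∃ m < 256, l.1 = aux + m) ∨ l.1 = 0 := by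
  intro l hl
  unfold Con.clause at hl
  split_ifs at hl with h1 h2
  · simp [tautClause] at hl; rcases hl with rfl | rfl <;> simp
  · have hρ : j / 4 < 64 := by omega
    have : j % 4 < 4 := Nat.mod_lt j (by decide)
    interval_cases hjm : (j % 4)
    all_goals simp only [Con.chain, List.mem_cons, List.not_mem_nil, or_false, if_true,
      if_false, show (1:ℕ) ≠ 0 by decide, show (2:ℕ) ≠ 0 by decide, show (2:ℕ) ≠ 1 by decide,
      show (3:ℕ) ≠ 0 by decide, show (3:ℕ) ≠ 1 by decide, show (3:ℕ) ≠ 2 by decide] at hl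
    all_goals rcases hl with rfl | rfl | rfl
    all_goals simp only [Con.lit]
    all_goals first
      | (left; exact ⟨_, rfl⟩)
      | (right; left; refine ⟨?_, ?_, ?_⟩; rotate_left 2
         first | rfl | (exact Nat.add_assoc _ _ _)
         omega)
  · simp [tautClause] at hl; rcases hl with rfl | rfl <;> simp

/-! ### Soundness -/

/-- Evaluation of a three-literal clause. [folklore] -/
theorem eval_three (σ : ℕ → Bool) (l₁ l₂ l₃ : Literal ℕ) :
    Clause.eval σ [l₁, l₂, l₃] = (l₁.eval σ || l₂.eval σ || l₃.eval σ) := by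
  simp [Clause.eval, Bool.or_assoc]

/-- A literal of the blocking clause of the row OF `σ` is false under `σ`. [folklore] -/
theorem eval_lit_rowOf (σ : ℕ → Bool) (c : Con) (i : Fin 6) :
    (c.lit (rowOf fun i => σ (c.vars i)) i).eval σ = false := by
  simp only [Con.lit, Literal.eval, row_rowOf]
  cases σ (c.vars i) <;> rfl

/-- **Soundness of the compilation**: an assignment under which all `256` clauses of the block
are true satisfies the constraint (on the row of the assignment itself the blocking chain cannot
be satisfied: its six literals are false and the three chain variables are forced in turn).
[cite: AroraBarak2009, Lemma 2.14] -/
theorem sat_of_clauses {σ : ℕ → Bool} {c : Con} {aux : ℕ}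
    (h : ∀ j < 256, (c.clause aux j).eval σ = true) : c.Sat σ := by
  by_contra hns
  set ρ := rowOf fun i => σ (c.vars i) with hρ
  have hρlt : ρ < 64 := rowOf_lt _
  have hpred : c.pred (row ρ) = false := by
    rw [hρ, row_rowOf]; simpa [Con.Sat] using hns
  have hcl : ∀ t < 4, (c.chain aux ρ t).eval σ = true := by
    intro t ht
    have hj := h (4 * ρ + t) (by omega)
    have hdiv : (4 * ρ + t) / 4 = ρ := by omega
    have hmod : (4 * ρ + t) % 4 = t := by omega
    simp only [Con.clause, show 4 * ρ + t < 256 by omega, if_true, hdiv, hpred, hmod] at hj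
    simpa using hj
  have hl : ∀ i, (c.lit ρ i).eval σ = false := fun i => by rw [hρ]; exact eval_lit_rowOf σ c i
  have h0 := hcl 0 (by decide); have h1 := hcl 1 (by decide)
  have h2 := hcl 2 (by decide); have h3 := hcl 3 (by decide)
  simp only [Con.chain, if_true, if_false, show (1:ℕ) ≠ 0 by decide, show (2:ℕ) ≠ 0 by decide,
    show (2:ℕ) ≠ 1 by decide, show (3:ℕ) ≠ 0 by decide, show (3:ℕ) ≠ 1 by decide,
    show (3:ℕ) ≠ 2 by decide] at h0 h1 h2 h3
  rw [eval_three, hl, hl] at h0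
  rw [eval_three, hl] at h1
  rw [eval_three, hl] at h2
  rw [eval_three, hl, hl] at h3
  simp only [Literal.eval, Bool.false_or, Bool.or_false] at h0 h1 h2 h3
  revert h0 h1 h2 h3
  cases σ (aux + 4 * ρ) <;> cases σ (aux + 4 * ρ + 1) <;> cases σ (aux + 4 * ρ + 2) <;> simp

/-! ### Completeness -/

/-- The first bit in which `α` differs from `β` (`6` if none). [folklore] -/
def firstDiff (α β : Fin 6 → Bool) : ℕ :=
  match (List.finRange 6).find? (fun i => α i != β i) with
  | some i => i.val
  | none => 6

/-- If `α ≠ β`, the first differing bit is a differing bit. [folklore] -/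
theorem firstDiff_spec {α β : Fin 6 → Bool} (h : α ≠ β) :
    ∃ i : Fin 6, firstDiff α β = i.val ∧ α i ≠ β i := by
  unfold firstDiff
  have hex : ∃ i ∈ List.finRange 6, (fun i => α i != β i) i = true := by
    by_contra hall
    apply h; funext i
    by_contra hi
    exact hall ⟨i, List.mem_finRange i, bne_iff_ne.2 hi⟩
  obtain hsome := List.find?_isSome.2 hex
  cases hf : (List.finRange 6).find? (fun i => α i != β i) with
  | none => rw [hf] at hsome; simp at hsome
  | some i =>
    refine ⟨i, rfl, ?_⟩
    have := List.find?_some hf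
    revert this; cases α i <;> cases β i <;> simp

/-- **The intended values of the auxiliary block** for an assignment `α` of the six variables:
variable `aux + (4ρ + t)` (`t < 3`) is `true` iff the first bit in which `α` differs from row
`ρ` is at least `t + 2` (so the chain is satisfied by the first true literal). [folklore] -/
def zval (α : Fin 6 → Bool) (m : ℕ) : Bool := decide (m % 4 + 2 ≤ firstDiff α (row (m / 4)))

/-- A literal of the blocking clause of row `ρ` is true under `σ` iff `σ` differs from `ρ` there.
[folklore] -/
theorem eval_lit (σ : ℕ → Bool) (c : Con) (ρ : ℕ) (i : Fin 6) :
    (c.lit ρ i).eval σ = ((fun i => σ (c.vars i)) i != row ρ i) := by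
  simp only [Con.lit, Literal.eval]
  cases σ (c.vars i) <;> cases row ρ i <;> rfl

/-- **Completeness of the compilation**: an assignment satisfying the constraint and giving the
auxiliary block its intended values satisfies every clause of the block.
[cite: AroraBarak2009, Lemma 2.14] -/
theorem clauses_of_sat {σ : ℕ → Bool} {c : Con} {aux : ℕ} (hs : c.Sat σ)
    (haux : ∀ m < 256, σ (aux + m) = zval (fun i => σ (c.vars i)) m) (j : ℕ) :
    (c.clause aux j).eval σ = true := by
  unfold Con.clause
  split_ifs with hj hpred
  · exact eval_tautClause σ
  · set ρ := j / 4 with hρ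
    set α : Fin 6 → Bool := fun i => σ (c.vars i) with hα
    have hs' : c.pred α = true := hs
    have hne : α ≠ row ρ := fun he => hpred (by rw [← he]; exact hs')
    obtain ⟨i, hi, hdiff⟩ := firstDiff_spec hne
    have hlit : (c.lit ρ i).eval σ = true := by
      rw [eval_lit]; revert hdiff; simp only [hα]; cases σ (c.vars i) <;> cases row ρ i <;> simp
    have hz : ∀ t < 3, σ (aux + 4 * ρ + t) = decide (t + 2 ≤ i.val) := by
      intro t ht
      have := haux (4 * ρ + t) (by omega)
      rw [Nat.add_assoc, this, zval]
      have hdiv : (4 * ρ + t) / 4 = ρ := by omega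
      have hmod : (4 * ρ + t) % 4 = t := by omega
      rw [hdiv, hmod, hi]
    have hz0 := hz 0 (by decide); have hz1 := hz 1 (by decide); have hz2 := hz 2 (by decide)
    rw [Nat.add_zero] at hz0
    have hlit' : σ (c.lit ρ i).1 = (c.lit ρ i).2 := by simpa [Literal.eval] using hlit
    have ht : j % 4 < 4 := Nat.mod_lt j (by decide)
    have hi6 := i.2
    interval_cases hjm : j % 4
    all_goals simp only [Con.chain, if_true, if_false, show (1:ℕ) ≠ 0 by decide,
      show (2:ℕ) ≠ 0 by decide, show (2:ℕ) ≠ 1 by decide, show (3:ℕ) ≠ 0 by decide,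
      show (3:ℕ) ≠ 1 by decide, show (3:ℕ) ≠ 2 by decide]
    · rw [eval_three]
      simp only [Literal.eval, hz0]
      rcases Nat.lt_or_ge i.val 2 with h2 | h2
      · have : i = 0 ∨ i = 1 := by omega
        rcases this with rfl | rfl <;> simp [hlit']
      · simp [h2]
    · rw [eval_three]
      simp only [Literal.eval, hz0, hz1]
      rcases lt_trichotomy i.val 2 with h2 | h2 | h2
      · simp; omega
      · have : i = 2 := Fin.ext h2
        subst this; simp [hlit']
      · simp; omega
    · rw [eval_three]
      simp only [Literal.eval, hz1, hz2]
      rcases lt_trichotomy i.val 3 with h2 | h2 | h2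
      · simp; omega
      · have : i = 3 := Fin.ext h2
        subst this; simp [hlit']
      · simp; omega
    · rw [eval_three]
      simp only [Literal.eval, hz2]
      rcases Nat.lt_or_ge i.val 4 with h2 | h2
      · simp; omega
      · have : i = 4 ∨ i = 5 := by omega
        rcases this with rfl | rfl <;> simp [hlit']
  · exact eval_tautClause σ

end ThreeCNF

end Literature.Computability.Complexity
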